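import Summits.QuantumFields.YangMills.Theorems.UnitScaleTiltProp7LatticeBoxPotentialAlgebra
import Summits.QuantumFields.YangMills.Theorems.UnitScaleTiltProp7LatticeBoxPoincareCov
import HarnessLib

/-!
# LANE II §4 (B8) — THE LOCAL COULOMB POTENTIAL ON A BOX (constrained least squares with an axial-constant source)

Item stmt-QuantumFields-19200 (`MinimiserStabilityRegPr`), LANE II «divergence recovery at curved `W`» (px4 g7 LOCATE #60 S1 with the
cure (C3); ★★OWNER RULING №23 (c): pen px4 g7; ★p1 g19 PLAN (B7) §1 «(B8) on each `Ω_i`»).  Tree letters of lit `B4Eq19LatticeOperators`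
(`Zd d`, `box z R`, `unitVec`), a unitary background `V : Zd d → Fin d → (M_N(ℂ))ˣ` with the plaquette bound `PlaqSmall V (z−R) (z+R) α`,
`R(u) := conjR u`, the box axial gauge `u := axialFn V (z−R)`.

For a one-form `y` read on the edges of the box `Q_R(z)` we construct a site potential `φ`, NORMALISED against the axial constants
(`Σ_{Q_R} R(u x)(φ x) = 0`), minimising the Frobenius energy `Σ_{edges} ‖y − ∇_Vφ‖_F²` over that class (orthogonal projection onto
`∇_V(S)` in a Euclidean packaging of the edge functions), and prove:
* (i′) PYTHAGORAS `Σ‖y‖_F² = Σ‖∇_Vφ‖_F² + Σ‖y − ∇_Vφ‖_F²` (edges of the box);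
* (ii) EULER–LAGRANGE WITH SOURCE: at every box site the patch divergence of `r := y − ∇_Vφ` is an AXIAL CONSTANT `R(u x)⁻¹m`;
* (iii′) SOURCE SIZE `|Q_R|·‖m‖_F² ≤ 16d³N·R²α²·Σ‖r‖_F²` (pairing the source with the axial constants, whose covariant gradient is `O(Rα)`);
* (iv) POINCARÉ `Σ_{Q_R}‖φ‖² ≤ 4N·R(2R+1)·Σ‖∇_Vφ‖²` in the window `64d³N·R³(2R+1)·α² ≤ 1` (✓(B9) in the axial gauge).
`boxLocalPotential` restates the rows in operator-norm currency (factors `N`).  Rung R3 brick; nothing about the YM gap is claimed.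
-/

open scoped BigOperators Matrix.Norms.L2Operator ComplexConjugate Matrix InnerProductSpace
open Finset

namespace Summit.QuantumFields.YangMills.Theorems.Prop7LatticeBoxLocalPotential

open Literature.MathematicalPhysics.QuantumFieldTheory.Balaban1983to89
open Literature.MathematicalPhysics.QuantumFieldTheory.Balaban1983to89.B4Eq19LatticeOperators
open B7Prop1Explicit (U1 gaugeAct axialFn gaugeAct_mem)
open B7Prop2Explicit (unitaryUnits mem_unitaryUnits)
open B7Eq78Linearization (conjR conjR_apply conjR_sub conjR_add conjR_smul)
open B8Ineq132 (norm_conjR conjR_conjR one_conjR)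
open Summit.QuantumFields.YangMills.Theorems.Prop7LatticeBoxPotentialAlgebra
open B9Thm311DeltaPrimePos (re_trace_conjTranspose_mul_self_nonneg)

variable {N d : ℕ}

/-! ## §0 Small algebra -/

/-- `Re tr((A+B)ᴴ(A+B)) = Re tr(AᴴA) + Re tr(BᴴB) + 2·Re tr(AᴴB)`. [folklore] -/
theorem re_trace_self_add (A B : Matrix (Fin N) (Fin N) ℂ) :
    (Matrix.trace ((A + B)ᴴ * (A + B))).re
      = (Matrix.trace (Aᴴ * A)).re + (Matrix.trace (Bᴴ * B)).re + 2 * (Matrix.trace (Aᴴ * B)).re := by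
  rw [Matrix.conjTranspose_add, Matrix.add_mul, Matrix.mul_add, Matrix.mul_add, Matrix.trace_add, Matrix.trace_add,
    Matrix.trace_add, Complex.add_re, Complex.add_re, Complex.add_re, re_trace_comm B A]
  ring

/-- The absorption step: if `2Q ≤ t·A·Q + t⁻¹·S` for every `t > 0` (`A, S ≥ 0`), then `Q ≤ A·S`. [folklore] -/
theorem le_mul_of_forall_two_mul_le {Q A S : ℝ} (hA : 0 ≤ A) (hS : 0 ≤ S)
    (h : ∀ t : ℝ, 0 < t → 2 * Q ≤ t * A * Q + t⁻¹ * S) : Q ≤ A * S := by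
  refine not_lt.1 fun hlt => ?_
  have hQ0 : 0 < Q := lt_of_le_of_lt (mul_nonneg hA hS) hlt
  rcases hA.eq_or_lt with hA0 | hA0
  · -- `A = 0`: `2Q ≤ S/t` for all `t`, absurd for `t` large
    have h1 := h ((S + 1) / Q) (div_pos (by linarith) hQ0)
    rw [← hA0, mul_zero, zero_mul, zero_add, inv_div] at h1
    have h2 : Q / (S + 1) * S ≤ Q := by
      rw [div_mul_eq_mul_div, div_le_iff₀ (by linarith : (0 : ℝ) < S + 1)]; nlinarith
    linarith
  · have h1 := h A⁻¹ (inv_pos.2 hA0)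
    rw [inv_mul_cancel₀ hA0.ne', one_mul, inv_inv] at h1
    linarith

/-- Edge sums: `Σ_{(x,μ) ∈ edges(Q)} f x μ = Σ_{x∈Q}Σ_μ [x+e_μ ∈ Q]·f x μ`. [folklore] -/
theorem sum_edges_eq {M : Type*} [AddCommMonoid M] (Q : Finset (Zd d)) (f : Zd d × Fin d → M) :
    ∑ p ∈ Finset.filter (fun p : Zd d × Fin d => p.1 + unitVec p.2 ∈ Q) (Q ×ˢ Finset.univ), f p
      = ∑ x ∈ Q, ∑ μ, (if x + unitVec μ ∈ Q then f (x, μ) else 0) := by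
  rw [Finset.sum_filter, Finset.sum_product]

/-- The Euclidean packaging of edge functions computes the Frobenius pairing: `⟪pack a, pack b⟫ = Σ_{edges} tr((a x μ)ᴴ(b x μ))`. [folklore] -/
theorem inner_pack_eq (E : Finset (Zd d × Fin d)) (a b : Zd d → Fin d → Matrix (Fin N) (Fin N) ℂ) :
    ⟪(WithLp.toLp 2 (fun i : ↥E × (Fin N × Fin N) => a i.1.1.1 i.1.1.2 i.2.1 i.2.2) : EuclideanSpace ℂ (↥E × (Fin N × Fin N))),
      (WithLp.toLp 2 (fun i : ↥E × (Fin N × Fin N) => b i.1.1.1 i.1.1.2 i.2.1 i.2.2) : EuclideanSpace ℂ (↥E × (Fin N × Fin N)))⟫_ℂ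
      = ∑ p ∈ E, Matrix.trace ((a p.1 p.2)ᴴ * b p.1 p.2) := by
  rw [PiLp.inner_apply, Fintype.sum_prod_type, ← Finset.sum_coe_sort E]
  refine Finset.sum_congr rfl fun e _ => ?_
  rw [trace_conjTranspose_mul_eq_sum, Fintype.sum_prod_type]
  refine Finset.sum_congr rfl fun j _ => Finset.sum_congr rfl fun k _ => ?_
  simp only [RCLike.inner_apply']

/-! ## §1 The local potential, Frobenius-trace currency -/

/-- ★★ **(B8) THE LOCAL COULOMB POTENTIAL ON A BOX — trace form.**  Let `0 ≤ R`, `V` unitary with `PlaqSmall V (z−R) (z+R) α`, `u := axialFn V (z−R)`,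
and assume the window `64·d³·N·R³(2R+1)·α² ≤ 1`.  For every one-form `y` there are a site function `φ` and a matrix `m` with
(0) `Σ_{Q_R} R(u x)(φ x) = 0`; (i′) `Σ_{edges}‖y‖_F² = Σ_{edges}‖∇_Vφ‖_F² + Σ_{edges}‖y − ∇_Vφ‖_F²`;
(ii) for every `x ∈ Q_R(z)`: `Σ_μ ([x−e_μ ∈ Q_R]·R(V(x−e_μ) μ)⁻¹ r(x−e_μ) μ − [x+e_μ ∈ Q_R]·r x μ) = R(u x)⁻¹ m`, `r := y − ∇_Vφ`;
(iii′) `|Q_R|·‖m‖_F² ≤ 16d³N·R²α²·Σ_{edges}‖r‖_F²`; (iv) `Σ_{Q_R}‖φ x‖² ≤ 4N·R(2R+1)·Σ_{edges}‖∇_Vφ‖²`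
(`∇_Vφ(x,μ) = R(V x μ)φ(x+e_μ) − φ x`, `‖·‖_F² = Re tr(·ᴴ·)`, `‖·‖` the operator norm).
[cite: Balaban1985BackgroundPropagators, (3.23) p.394; folklore (finite-dimensional least squares)] -/
theorem boxLocalPotential_trace [NeZero N] {z : Zd d} {R : ℤ} (hR : 0 ≤ R) {α : ℝ} (hα : 0 ≤ α)
    (V : Zd d → Fin d → (Matrix (Fin N) (Fin N) ℂ)ˣ) (hV : ∀ y μ, V y μ ∈ unitaryUnits (Matrix (Fin N) (Fin N) ℂ))
    (hP : B8Lemma1NonAbelian.PlaqSmall V (fun i => z i - R) (fun i => z i + R) α)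
    (hw : 64 * (d : ℝ) ^ 3 * N * R ^ 3 * (2 * R + 1) * α ^ 2 ≤ 1)
    (y : Zd d → Fin d → Matrix (Fin N) (Fin N) ℂ) :
    ∃ (φ : Zd d → Matrix (Fin N) (Fin N) ℂ) (m : Matrix (Fin N) (Fin N) ℂ),
      (∑ x ∈ box z R, conjR (axialFn V (fun i => z i - R) x) (φ x) = 0) ∧
      (∑ x ∈ box z R, ∑ μ, (if x + unitVec μ ∈ box z R then (Matrix.trace ((y x μ)ᴴ * y x μ)).re else 0)
        = ∑ x ∈ box z R, ∑ μ, (if x + unitVec μ ∈ box z R then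
              (Matrix.trace ((conjR (V x μ) (φ (x + unitVec μ)) - φ x)ᴴ * (conjR (V x μ) (φ (x + unitVec μ)) - φ x))).re else 0)
          + ∑ x ∈ box z R, ∑ μ, (if x + unitVec μ ∈ box z R then
              (Matrix.trace ((y x μ - (conjR (V x μ) (φ (x + unitVec μ)) - φ x))ᴴ * (y x μ - (conjR (V x μ) (φ (x + unitVec μ)) - φ x)))).re
            else 0)) ∧
      (∀ x ∈ box z R,
        ∑ μ, ((if x - unitVec μ ∈ box z R then
                conjR (V (x - unitVec μ) μ)⁻¹ (y (x - unitVec μ) μ - (conjR (V (x - unitVec μ) μ) (φ x) - φ (x - unitVec μ))) else 0)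
              - (if x + unitVec μ ∈ box z R then (y x μ - (conjR (V x μ) (φ (x + unitVec μ)) - φ x)) else 0))
          = conjR (axialFn V (fun i => z i - R) x)⁻¹ m) ∧
      (((box z R).card : ℝ) * (Matrix.trace (mᴴ * m)).re
        ≤ 16 * (d : ℝ) ^ 3 * N * R ^ 2 * α ^ 2 *
            ∑ x ∈ box z R, ∑ μ, (if x + unitVec μ ∈ box z R then
              (Matrix.trace ((y x μ - (conjR (V x μ) (φ (x + unitVec μ)) - φ x))ᴴ * (y x μ - (conjR (V x μ) (φ (x + unitVec μ)) - φ x)))).re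
            else 0)) ∧
      (∑ x ∈ box z R, ‖φ x‖ ^ 2
        ≤ 4 * N * R * (2 * R + 1) *
            ∑ x ∈ box z R, ∑ μ, (if x + unitVec μ ∈ box z R then ‖conjR (V x μ) (φ (x + unitVec μ)) - φ x‖ ^ 2 else 0)) := by
  classical
  -- letters
  set u : Zd d → (Matrix (Fin N) (Fin N) ℂ)ˣ := axialFn V (fun i => z i - R) with hu_def
  have hV1 : ∀ x μ, V x μ ∈ U1 (Matrix (Fin N) (Fin N) ℂ) := fun x μ => mem_U1_of_mem_unitaryUnits (hV x μ)
  have hu : ∀ x, u x ∈ unitaryUnits (Matrix (Fin N) (Fin N) ℂ) := fun x => B7Prop2Explicit.hol_mem_of hV _ _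
  have hu1 : ∀ x, u x ∈ U1 (Matrix (Fin N) (Fin N) ℂ) := fun x => mem_U1_of_mem_unitaryUnits (hu x)
  have hui : ∀ x, (u x)⁻¹ ∈ unitaryUnits (Matrix (Fin N) (Fin N) ℂ) := fun x => (unitaryUnits _).inv_mem (hu x)
  -- ### the Euclidean packaging of the edge functions
  set E : Finset (Zd d × Fin d) := Finset.filter (fun p : Zd d × Fin d => p.1 + unitVec p.2 ∈ box z R) (box z R ×ˢ Finset.univ)
    with hE
  have hmemE : ∀ p ∈ E, p.1 ∈ box z R ∧ p.1 + unitVec p.2 ∈ box z R := by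
    intro p hp
    rw [hE, Finset.mem_filter, Finset.mem_product] at hp
    exact ⟨hp.1.1, hp.2⟩
  let pack : (Zd d → Fin d → Matrix (Fin N) (Fin N) ℂ) → EuclideanSpace ℂ (↥E × (Fin N × Fin N)) :=
    fun a => WithLp.toLp 2 (fun i : ↥E × (Fin N × Fin N) => a i.1.1.1 i.1.1.2 i.2.1 i.2.2)
  have pack_inner : ∀ a b, ⟪pack a, pack b⟫_ℂ = ∑ p ∈ E, Matrix.trace ((a p.1 p.2)ᴴ * b p.1 p.2) :=
    fun a b => inner_pack_eq E a b
  -- the packaged covariant gradient (linear) and the axial mean (linear)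
  let gradP : (Zd d → Matrix (Fin N) (Fin N) ℂ) →ₗ[ℂ] EuclideanSpace ℂ (↥E × (Fin N × Fin N)) :=
    { toFun := fun ψ => pack (fun x μ => conjR (V x μ) (ψ (x + unitVec μ)) - ψ x)
      map_add' := by
        intro ψ ψ'; ext i
        simp only [pack, Pi.add_apply, conjR_add, PiLp.add_apply, Matrix.add_apply, Matrix.sub_apply]
        ring
      map_smul' := by
        intro c ψ; ext i
        simp only [pack, Pi.smul_apply, conjR_smul, PiLp.smul_apply, Matrix.smul_apply, Matrix.sub_apply,
          smul_eq_mul, RingHom.id_apply]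
        ring }
  have gradP_apply : ∀ ψ, gradP ψ = pack (fun x μ => conjR (V x μ) (ψ (x + unitVec μ)) - ψ x) := fun ψ => rfl
  let meanL : (Zd d → Matrix (Fin N) (Fin N) ℂ) →ₗ[ℂ] Matrix (Fin N) (Fin N) ℂ :=
    { toFun := fun ψ => ∑ x ∈ box z R, conjR (u x) (ψ x)
      map_add' := by intro ψ ψ'; simp only [Pi.add_apply, conjR_add, Finset.sum_add_distrib]
      map_smul' := by intro c ψ; simp only [Pi.smul_apply, conjR_smul, Finset.smul_sum, RingHom.id_apply] }
  have meanL_apply : ∀ ψ, meanL ψ = ∑ x ∈ box z R, conjR (u x) (ψ x) := fun ψ => rfl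
  let S : Submodule ℂ (Zd d → Matrix (Fin N) (Fin N) ℂ) := LinearMap.ker meanL
  let K : Submodule ℂ (EuclideanSpace ℂ (↥E × (Fin N × Fin N))) := S.map gradP
  -- ### the minimiser: orthogonal projection of `pack y` onto `∇_V(S)`
  obtain ⟨φ, hφS, hφ⟩ := Submodule.mem_map.1 (K.starProjection_apply_mem (pack y))
  have hφ0 : ∑ x ∈ box z R, conjR (u x) (φ x) = 0 := by
    have : meanL φ = 0 := LinearMap.mem_ker.1 hφS
    rwa [meanL_apply] at this
  have horth : ∀ ψ : Zd d → Matrix (Fin N) (Fin N) ℂ, ∑ x ∈ box z R, conjR (u x) (ψ x) = 0 →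
      ⟪pack y - gradP φ, gradP ψ⟫_ℂ = 0 := by
    intro ψ hψ
    have hmem : gradP ψ ∈ K := Submodule.mem_map_of_mem (LinearMap.mem_ker.2 (by rw [meanL_apply, hψ]))
    have := Submodule.starProjection_inner_eq_zero (K := K) (pack y) (gradP ψ) hmem
    rw [← hφ] at this
    exact this
  -- ### function side: the remainder `r := [edge]·(y − ∇_Vφ)` and the Euler–Lagrange identity
  set r : Zd d → Fin d → Matrix (Fin N) (Fin N) ℂ :=
    fun x μ => if x ∈ box z R ∧ x + unitVec μ ∈ box z R then y x μ - (conjR (V x μ) (φ (x + unitVec μ)) - φ x) else 0 with hr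
  have hr0 : ∀ (x : Zd d) (μ : Fin d), (x ∉ box z R ∨ x + unitVec μ ∉ box z R) → r x μ = 0 := by
    intro x μ h; simp only [hr]; rw [if_neg (not_and_or.2 h)]
  have hr1 : ∀ (x : Zd d) (μ : Fin d), x ∈ box z R → x + unitVec μ ∈ box z R →
      r x μ = y x μ - (conjR (V x μ) (φ (x + unitVec μ)) - φ x) := by
    intro x μ hx hxμ; simp only [hr]; rw [if_pos ⟨hx, hxμ⟩]
  have hpack_r : pack y - gradP φ = pack r := by
    ext i
    obtain ⟨⟨p, hp⟩, jk⟩ := i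
    obtain ⟨hpB, hpB'⟩ := hmemE p hp
    simp only [gradP_apply, pack, PiLp.sub_apply, Matrix.sub_apply, hr1 p.1 p.2 hpB hpB']
  have hEL : ∀ ψ : Zd d → Matrix (Fin N) (Fin N) ℂ, ∑ x ∈ box z R, conjR (u x) (ψ x) = 0 →
      ∑ x ∈ box z R, ∑ μ, (Matrix.trace ((conjR (V x μ) (ψ (x + unitVec μ)) - ψ x)ᴴ * r x μ)).re = 0 := by
    intro ψ hψ
    have h0 := horth ψ hψ
    rw [hpack_r, gradP_apply] at h0
    have h : ∑ p ∈ E, Matrix.trace ((r p.1 p.2)ᴴ * (conjR (V p.1 p.2) (ψ (p.1 + unitVec p.2)) - ψ p.1)) = 0 :=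
      (pack_inner r (fun x μ => conjR (V x μ) (ψ (x + unitVec μ)) - ψ x)).symm.trans h0
    rw [hE, sum_edges_eq] at h
    have h' := congrArg Complex.re h
    rw [Complex.zero_re, Complex.re_sum] at h'
    rw [← h']
    refine Finset.sum_congr rfl fun x _ => ?_
    rw [Complex.re_sum]
    refine Finset.sum_congr rfl fun μ _ => ?_
    split_ifs with hxμ
    · exact re_trace_comm _ _
    · rw [hr0 x μ (Or.inr hxμ), Matrix.mul_zero, Matrix.trace_zero, Complex.zero_re]
  -- ### the source: the patch divergence of `r` is an axial constant (duality)
  set m : Matrix (Fin N) (Fin N) ℂ := (((box z R).card : ℝ) : ℂ)⁻¹ •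
      ∑ x' ∈ box z R, conjR (u x') (∑ μ, (conjR (V (x' - unitVec μ) μ)⁻¹ (r (x' - unitVec μ) μ) - r x' μ)) with hm
  have hDm : ∀ x ∈ box z R, (∑ μ, (conjR (V (x - unitVec μ) μ)⁻¹ (r (x - unitVec μ) μ) - r x μ)) = conjR (u x)⁻¹ m := by
    refine eq_axialConst_of_sum_re_trace_eq_zero hR u hu
      (fun x => ∑ μ, (conjR (V (x - unitVec μ) μ)⁻¹ (r (x - unitVec μ) μ) - r x μ)) fun ψ hψ => ?_
    rw [← sum_re_trace_grad_eq_sum_re_trace_div V hV r hr0 ψ]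
    exact hEL ψ hψ
  -- ### the rows
  refine ⟨φ, m, hφ0, ?_, ?_, ?_, ?_⟩
  · -- (i′) Pythagoras
    have hcross := hEL φ hφ0
    calc ∑ x ∈ box z R, ∑ μ, (if x + unitVec μ ∈ box z R then (Matrix.trace ((y x μ)ᴴ * y x μ)).re else 0)
        = ∑ x ∈ box z R, ∑ μ,
            ((if x + unitVec μ ∈ box z R then
                (Matrix.trace ((conjR (V x μ) (φ (x + unitVec μ)) - φ x)ᴴ * (conjR (V x μ) (φ (x + unitVec μ)) - φ x))).re else 0)
              + (if x + unitVec μ ∈ box z R then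
                (Matrix.trace ((y x μ - (conjR (V x μ) (φ (x + unitVec μ)) - φ x))ᴴ
                  * (y x μ - (conjR (V x μ) (φ (x + unitVec μ)) - φ x)))).re else 0)
              + 2 * (Matrix.trace ((conjR (V x μ) (φ (x + unitVec μ)) - φ x)ᴴ * r x μ)).re) := by
          refine Finset.sum_congr rfl fun x hx => Finset.sum_congr rfl fun μ _ => ?_
          split_ifs with hxμ
          · rw [hr1 x μ hx hxμ, ← re_trace_self_add, add_sub_cancel]
          · rw [hr0 x μ (Or.inr hxμ), Matrix.mul_zero, Matrix.trace_zero, Complex.zero_re]; ring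
      _ = _ := by
          simp only [Finset.sum_add_distrib, ← Finset.mul_sum]
          rw [hcross, mul_zero, add_zero]
  · -- (ii) Euler–Lagrange with source
    intro x hx
    rw [← hDm x hx]
    refine Finset.sum_congr rfl fun μ _ => ?_
    congr 1
    · by_cases hxm : x - unitVec μ ∈ box z R
      · rw [if_pos hxm, hr1 (x - unitVec μ) μ hxm (by rwa [sub_add_cancel]), sub_add_cancel]
      · rw [if_neg hxm, hr0 (x - unitVec μ) μ (Or.inl hxm), conjR_apply, mul_zero, zero_mul]
    · by_cases hxμ : x + unitVec μ ∈ box z R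
      · rw [if_pos hxμ, hr1 x μ hx hxμ]
      · rw [if_neg hxμ, hr0 x μ (Or.inr hxμ)]
  · -- (iii′) source size, by Young + absorption
    -- `Q := |Q_R|·‖m‖_F² = Σ_{Q_R} ‖R(u x)⁻¹m‖_F² = Σ_{Q_R} Re tr((R(u x)⁻¹m)ᴴ · div r x) = Σ_{edges} Re tr((∇_V ψ_m)ᴴ r)`
    have hQ : ((box z R).card : ℝ) * (Matrix.trace (mᴴ * m)).re
        = ∑ x ∈ box z R, ∑ μ, (Matrix.trace ((conjR (V x μ) (conjR (u (x + unitVec μ))⁻¹ m) - conjR (u x)⁻¹ m)ᴴ * r x μ)).re := by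
      rw [sum_re_trace_grad_eq_sum_re_trace_div V hV r hr0 (fun x => conjR (u x)⁻¹ m)]
      rw [Finset.sum_congr rfl fun x hx => by rw [hDm x hx, re_trace_conjR_conjR (hui x)], Finset.sum_const, nsmul_eq_mul]
    -- the remainder energy without indicator
    have hRR : ∑ x ∈ box z R, ∑ μ, (if x + unitVec μ ∈ box z R then
          (Matrix.trace ((y x μ - (conjR (V x μ) (φ (x + unitVec μ)) - φ x))ᴴ * (y x μ - (conjR (V x μ) (φ (x + unitVec μ)) - φ x)))).re
          else 0)
        = ∑ x ∈ box z R, ∑ μ, (Matrix.trace ((r x μ)ᴴ * r x μ)).re := by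
      refine Finset.sum_congr rfl fun x hx => Finset.sum_congr rfl fun μ _ => ?_
      split_ifs with hxμ
      · rw [hr1 x μ hx hxμ]
      · rw [hr0 x μ (Or.inr hxμ), Matrix.mul_zero, Matrix.trace_zero, Complex.zero_re]
    rw [hRR]
    have hS : 0 ≤ ∑ x ∈ box z R, ∑ μ, (Matrix.trace ((r x μ)ᴴ * r x μ)).re :=
      Finset.sum_nonneg fun x _ => Finset.sum_nonneg fun μ _ => re_trace_conjTranspose_mul_self_nonneg _
    refine le_mul_of_forall_two_mul_le (by positivity) hS fun t ht => ?_
    -- termwise Young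
    have hterm : ∀ x ∈ box z R, ∀ μ : Fin d,
        2 * (Matrix.trace ((conjR (V x μ) (conjR (u (x + unitVec μ))⁻¹ m) - conjR (u x)⁻¹ m)ᴴ * r x μ)).re
          ≤ t * (N * (4 * d * R * α) ^ 2 * (Matrix.trace (mᴴ * m)).re) + t⁻¹ * (Matrix.trace ((r x μ)ᴴ * r x μ)).re := by
      intro x hx μ
      by_cases hxμ : x + unitVec μ ∈ box z R
      · refine (two_mul_re_trace_le ht _ _).trans (add_le_add ?_ le_rfl)
        exact mul_le_mul_of_nonneg_left (re_trace_self_grad_axialConst_le hα V hV hP m x μ hx hxμ) ht.le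
      · rw [hr0 x μ (Or.inr hxμ), Matrix.mul_zero, Matrix.trace_zero, Complex.zero_re, mul_zero,
          Matrix.conjTranspose_zero, Matrix.zero_mul, Matrix.trace_zero, Complex.zero_re, mul_zero, add_zero]
        exact mul_nonneg ht.le (mul_nonneg (by positivity) (re_trace_conjTranspose_mul_self_nonneg m))
    calc 2 * (((box z R).card : ℝ) * (Matrix.trace (mᴴ * m)).re)
        = ∑ x ∈ box z R, ∑ μ, 2 * (Matrix.trace ((conjR (V x μ) (conjR (u (x + unitVec μ))⁻¹ m) - conjR (u x)⁻¹ m)ᴴ * r x μ)).re := by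
          rw [hQ, Finset.mul_sum]; simp only [Finset.mul_sum]
      _ ≤ ∑ x ∈ box z R, ∑ μ : Fin d,
            (t * (N * (4 * d * R * α) ^ 2 * (Matrix.trace (mᴴ * m)).re) + t⁻¹ * (Matrix.trace ((r x μ)ᴴ * r x μ)).re) :=
          Finset.sum_le_sum fun x hx => Finset.sum_le_sum fun μ _ => hterm x hx μ
      _ = t * (16 * (d : ℝ) ^ 3 * N * R ^ 2 * α ^ 2) * (((box z R).card : ℝ) * (Matrix.trace (mᴴ * m)).re)
            + t⁻¹ * ∑ x ∈ box z R, ∑ μ, (Matrix.trace ((r x μ)ᴴ * r x μ)).re := by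
          simp only [Finset.sum_add_distrib, Finset.sum_const, Finset.card_univ, Fintype.card_fin, ← Finset.mul_sum]
          ring
  · -- (iv) Poincaré in the axial gauge (✓(B9) at `T := V^u`, `w := R(u ·)φ`, zero mean by (0))
    have hB9 := Prop7LatticeBoxPoincareCov.sum_sq_sub_mean_le_box_cov (N := N) hR (β := 2 * d * R * α) (gaugeAct u V)
      (fun x μ => gaugeAct_mem hV1 hu1 x μ)
      (fun x μ hx hxμ => Prop7LatticeBoxFriedrichsCurved.norm_axial_sub_one_le_of_plaqSmall hα V hV1 hP x μ hx hxμ)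
      (fun x => conjR (u x) (φ x))
    have e1 : ∀ x, ‖conjR (u x) (φ x)‖ = ‖φ x‖ := fun x => norm_conjR (hu1 x) (φ x)
    have e2 : ∀ (x : Zd d) (μ : Fin d),
        ‖conjR (gaugeAct u V x μ) (conjR (u (x + unitVec μ)) (φ (x + unitVec μ))) - conjR (u x) (φ x)‖
          = ‖conjR (V x μ) (φ (x + unitVec μ)) - φ x‖ := by
      intro x μ
      rw [Prop7LatticeBoxFriedrichsCurved.conjR_gaugeAct_conjR, ← conjR_sub, norm_conjR (hu1 x)]
    rw [hφ0, smul_zero] at hB9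
    simp only [sub_zero, e1, e2] at hB9
    have hPnn : 0 ≤ ∑ x ∈ box z R, ‖φ x‖ ^ 2 := Finset.sum_nonneg fun x _ => by positivity
    have hRnn : (0 : ℝ) ≤ R := by exact_mod_cast hR
    have hc : 32 * (d : ℝ) ^ 3 * N * R ^ 3 * (2 * R + 1) * α ^ 2 ≤ 1 / 2 := by linarith
    have h1 := mul_le_mul_of_nonneg_right hc hPnn
    have e3 : (N : ℝ) * ((R : ℝ) * (2 * R + 1)) *
          (2 * ∑ x ∈ box z R, ∑ μ, (if x + unitVec μ ∈ box z R then ‖conjR (V x μ) (φ (x + unitVec μ)) - φ x‖ ^ 2 else 0)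
            + 8 * d * (2 * d * R * α) ^ 2 * ∑ x ∈ box z R, ‖φ x‖ ^ 2)
        = 2 * N * R * (2 * R + 1) * ∑ x ∈ box z R, ∑ μ, (if x + unitVec μ ∈ box z R then ‖conjR (V x μ) (φ (x + unitVec μ)) - φ x‖ ^ 2 else 0)
          + 32 * (d : ℝ) ^ 3 * N * R ^ 3 * (2 * R + 1) * α ^ 2 * ∑ x ∈ box z R, ‖φ x‖ ^ 2 := by ring
    rw [e3] at hB9
    linarith

/-! ## §2 Operator-norm currency (the rows displayed in ★p1 g19's skeleton §4 (B8)) -/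

/-- ★★ **(B8) THE LOCAL COULOMB POTENTIAL ON A BOX** (operator-norm rows; `u := axialFn V (z−R)`, window `64·d³·N·R³(2R+1)·α² ≤ 1`): for every one-form
`y` there are site functions `φ` (⊥ the axial constants) and `κ` (an axial constant `R(u x)⁻¹m`) with
(i) `Σ_{edges}‖∇_Vφ‖² ≤ N·Σ_{edges}‖y‖²`, `Σ_{edges}‖y − ∇_Vφ‖² ≤ N·Σ_{edges}‖y‖²`; (ii) patch-`div_V(y − ∇_Vφ) = κ` at every box site;
(iii) `Σ_{Q_R}‖κ x‖² ≤ 16d³N²·R²α²·Σ_{edges}‖y‖²` (`= 0` at `α = 0`); (iv) `Σ_{Q_R}‖φ x‖² ≤ 4N·R(2R+1)·Σ_{edges}‖∇_Vφ‖²`.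
[cite: Balaban1985BackgroundPropagators, (3.23) p.394; folklore (finite-dimensional least squares)] -/
theorem boxLocalPotential [NeZero N] {z : Zd d} {R : ℤ} (hR : 0 ≤ R) {α : ℝ} (hα : 0 ≤ α)
    (V : Zd d → Fin d → (Matrix (Fin N) (Fin N) ℂ)ˣ) (hV : ∀ y μ, V y μ ∈ unitaryUnits (Matrix (Fin N) (Fin N) ℂ))
    (hP : B8Lemma1NonAbelian.PlaqSmall V (fun i => z i - R) (fun i => z i + R) α)
    (hw : 64 * (d : ℝ) ^ 3 * N * R ^ 3 * (2 * R + 1) * α ^ 2 ≤ 1)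
    (y : Zd d → Fin d → Matrix (Fin N) (Fin N) ℂ) :
    ∃ (φ κ : Zd d → Matrix (Fin N) (Fin N) ℂ),
      (∑ x ∈ box z R, conjR (axialFn V (fun i => z i - R) x) (φ x) = 0) ∧
      (∑ x ∈ box z R, ∑ μ, (if x + unitVec μ ∈ box z R then ‖conjR (V x μ) (φ (x + unitVec μ)) - φ x‖ ^ 2 else 0)
        ≤ N * ∑ x ∈ box z R, ∑ μ, (if x + unitVec μ ∈ box z R then ‖y x μ‖ ^ 2 else 0)) ∧
      (∑ x ∈ box z R, ∑ μ, (if x + unitVec μ ∈ box z R then ‖y x μ - (conjR (V x μ) (φ (x + unitVec μ)) - φ x)‖ ^ 2 else 0)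
        ≤ N * ∑ x ∈ box z R, ∑ μ, (if x + unitVec μ ∈ box z R then ‖y x μ‖ ^ 2 else 0)) ∧
      (∀ x ∈ box z R,
        ∑ μ, ((if x - unitVec μ ∈ box z R then
                conjR (V (x - unitVec μ) μ)⁻¹ (y (x - unitVec μ) μ - (conjR (V (x - unitVec μ) μ) (φ x) - φ (x - unitVec μ))) else 0)
              - (if x + unitVec μ ∈ box z R then (y x μ - (conjR (V x μ) (φ (x + unitVec μ)) - φ x)) else 0))
          = κ x) ∧
      (∃ m : Matrix (Fin N) (Fin N) ℂ, ∀ x, κ x = conjR (axialFn V (fun i => z i - R) x)⁻¹ m) ∧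
      (∑ x ∈ box z R, ‖κ x‖ ^ 2
        ≤ 16 * (d : ℝ) ^ 3 * N ^ 2 * R ^ 2 * α ^ 2 * ∑ x ∈ box z R, ∑ μ, (if x + unitVec μ ∈ box z R then ‖y x μ‖ ^ 2 else 0)) ∧
      (∑ x ∈ box z R, ‖φ x‖ ^ 2
        ≤ 4 * N * R * (2 * R + 1) *
            ∑ x ∈ box z R, ∑ μ, (if x + unitVec μ ∈ box z R then ‖conjR (V x μ) (φ (x + unitVec μ)) - φ x‖ ^ 2 else 0)) := by
  classical
  obtain ⟨φ, m, h0, h1, h2, h3, h4⟩ := boxLocalPotential_trace hR hα V hV hP hw y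
  set u : Zd d → (Matrix (Fin N) (Fin N) ℂ)ˣ := axialFn V (fun i => z i - R) with hu_def
  have hu : ∀ x, u x ∈ unitaryUnits (Matrix (Fin N) (Fin N) ℂ) := fun x => B7Prop2Explicit.hol_mem_of hV _ _
  have hu1i : ∀ x, (u x)⁻¹ ∈ U1 (Matrix (Fin N) (Fin N) ℂ) := fun x => mem_U1_of_mem_unitaryUnits ((unitaryUnits _).inv_mem (hu x))
  -- generic comparison of edge sums
  have hmono : ∀ F G : Zd d → Fin d → ℝ, (∀ x ∈ box z R, ∀ μ : Fin d, x + unitVec μ ∈ box z R → F x μ ≤ G x μ) →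
      ∑ x ∈ box z R, ∑ μ, (if x + unitVec μ ∈ box z R then F x μ else 0)
        ≤ ∑ x ∈ box z R, ∑ μ, (if x + unitVec μ ∈ box z R then G x μ else 0) := by
    intro F G hFG
    refine Finset.sum_le_sum fun x hx => Finset.sum_le_sum fun μ _ => ?_
    split_ifs with hxμ
    · exact hFG x hx μ hxμ
    · exact le_rfl
  have hscale : ∀ (c : ℝ) (F : Zd d → Fin d → ℝ),
      ∑ x ∈ box z R, ∑ μ, (if x + unitVec μ ∈ box z R then c * F x μ else 0)
        = c * ∑ x ∈ box z R, ∑ μ, (if x + unitVec μ ∈ box z R then F x μ else 0) := by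
    intro c F
    rw [Finset.mul_sum]
    refine Finset.sum_congr rfl fun x _ => ?_
    rw [Finset.mul_sum]
    refine Finset.sum_congr rfl fun μ _ => ?_
    split_ifs <;> simp
  -- abbreviations
  set GRt := ∑ x ∈ box z R, ∑ μ, (if x + unitVec μ ∈ box z R then
      (Matrix.trace ((conjR (V x μ) (φ (x + unitVec μ)) - φ x)ᴴ * (conjR (V x μ) (φ (x + unitVec μ)) - φ x))).re else 0) with hGRt
  set RRt := ∑ x ∈ box z R, ∑ μ, (if x + unitVec μ ∈ box z R then
      (Matrix.trace ((y x μ - (conjR (V x μ) (φ (x + unitVec μ)) - φ x))ᴴ * (y x μ - (conjR (V x μ) (φ (x + unitVec μ)) - φ x)))).re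
      else 0) with hRRt
  set YYt := ∑ x ∈ box z R, ∑ μ, (if x + unitVec μ ∈ box z R then (Matrix.trace ((y x μ)ᴴ * y x μ)).re else 0) with hYYt
  set YY := ∑ x ∈ box z R, ∑ μ, (if x + unitVec μ ∈ box z R then ‖y x μ‖ ^ 2 else 0) with hYY
  have hGRt0 : 0 ≤ GRt := Finset.sum_nonneg fun x _ => Finset.sum_nonneg fun μ _ => by
    split_ifs
    · exact re_trace_conjTranspose_mul_self_nonneg _
    · exact le_rfl
  have hRRt0 : 0 ≤ RRt := Finset.sum_nonneg fun x _ => Finset.sum_nonneg fun μ _ => by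
    split_ifs
    · exact re_trace_conjTranspose_mul_self_nonneg _
    · exact le_rfl
  have hYYt : YYt ≤ N * YY := by
    rw [hYY, ← hscale]
    exact hmono _ _ fun x _ μ _ => re_trace_self_le_mul_opNorm_sq _
  have hGR : GRt ≤ N * YY := by linarith
  have hRR : RRt ≤ N * YY := by linarith
  refine ⟨φ, fun x => conjR (u x)⁻¹ m, h0, ?_, ?_, h2, ⟨m, fun x => rfl⟩, ?_, h4⟩
  · exact (hmono _ _ fun x _ μ _ => opNorm_sq_le_re_trace_self _).trans hGR
  · exact (hmono _ _ fun x _ μ _ => opNorm_sq_le_re_trace_self _).trans hRR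
  · -- `Σ_{Q_R}‖R(u x)⁻¹m‖² = |Q_R|·‖m‖² ≤ |Q_R|·‖m‖_F² ≤ 16d³N R²α²·RRt ≤ 16d³N²R²α²·YY`
    have e1 : ∀ x, ‖conjR (u x)⁻¹ m‖ = ‖m‖ := fun x => norm_conjR (hu1i x) m
    simp only [e1, Finset.sum_const, nsmul_eq_mul]
    have hc : (0 : ℝ) ≤ 16 * (d : ℝ) ^ 3 * N * R ^ 2 * α ^ 2 := by positivity
    calc ((box z R).card : ℝ) * ‖m‖ ^ 2 ≤ ((box z R).card : ℝ) * (Matrix.trace (mᴴ * m)).re :=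
          mul_le_mul_of_nonneg_left (opNorm_sq_le_re_trace_self m) (Nat.cast_nonneg _)
      _ ≤ 16 * (d : ℝ) ^ 3 * N * R ^ 2 * α ^ 2 * RRt := h3
      _ ≤ 16 * (d : ℝ) ^ 3 * N * R ^ 2 * α ^ 2 * (N * YY) := mul_le_mul_of_nonneg_left hRR hc
      _ = 16 * (d : ℝ) ^ 3 * N ^ 2 * R ^ 2 * α ^ 2 * YY := by ring

end Summit.QuantumFields.YangMills.Theorems.Prop7LatticeBoxLocalPotential
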